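import Summits.CriticalPhenomena.PercolationContinuityZ3.Theorems.PercNearOneGluingNoHeavyLowerTailSahiAbsorbedHeadBlocks
import Summits.CriticalPhenomena.PercolationContinuityZ3.Theorems.PercNearOneGluingNoHeavyLowerTailSahiAbsorbedIndependent

/-!
# A closed form for `E_{n+2}` with a mutually independent TAIL:
# `E_{n+2}(g, f_0,…,f_n) = (n+1)!·E[g·Π_j f_j] − n!·Σ_j E[f_j]·E[g·Π_{k≠j} f_k]`

Support file (lane `prim-masterthm-p3`, generation 18; `--supports stmt-CriticalPhenomena-4575`).  Pure proofs, no definitions,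
no `sorry`, standard axioms.

If the TAIL members `f_0,…,f_n` are mutually independent under a weight of mass one (all their joint moments factor) — the head `g`
being arbitrary — then in the head block expansion `E_{n+2}(g,f) = Σ_S |S|!·E[g·Π_S f]·ncs(f_{∁S})` (`sahiE_cons_eq_sum_powerset`) every
complementary factor with `|∁S| ≥ 2` vanishes (`ncs = −E_{|∁S|}` of an independent family, `sahiE_eq_zero_of_indep`), `ncs(∅) = 1` and
`ncs({j}) = −E[f_j]`; hence the closed form `sahiE_cons_eq_of_indep_tail`.  For a point-mass head and three orthogonal SLABS of
thicknesses `a, b, c` in `[4]^3` (uniform axis weights) this is the lane's slab profile formula `P ∝ (12 − a − b − c) | −t | 0`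
(HIERARCHY §26(q)): the value-level structure behind the adversarial minimisers of the open cell `(3,4)`. [this work]
-/

namespace Summit.CriticalPhenomena.PercolationContinuityZ3.Theorems

open Finset Function Equiv Equiv.Perm
open Literature.Combinatorics.Sahi2008 Literature.Combinatorics.Sahi2008.CycleForm

namespace SahiAbsorbed

section IndependentTail

variable {α : Type*} [Fintype α] (μ : α → ℝ) {n : ℕ} (f : Fin n → α → ℝ)

/-- `ncs` of a single member is minus its mean. [this work] -/
theorem ncs_singleton [DecidableEq (Fin n)] (j : Fin n) : ncs μ f {j} = - ex μ (f j) := by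
  classical
  rw [ncs_eq_neg_cycleSum μ f (singleton_nonempty j)]
  congr 1
  let e : Fin 1 ≃ {x // x ∈ ({j} : Finset (Fin n))} :=
    { toFun := fun _ => ⟨j, mem_singleton_self j⟩
      invFun := fun _ => 0
      left_inv := fun i => (Fin.fin_one_eq_zero i).symm
      right_inv := fun x => Subtype.ext (mem_singleton.1 x.2).symm }
  rw [← cycleSum_comp_equiv μ e, ← sahiE_eq_cycleSum μ le_rfl, sahiE_one_apply]
  rfl

/-- `ncs` of an independent sub-family with at least two members vanishes (zero locus). [this work] -/
theorem ncs_eq_zero_of_indep [DecidableEq (Fin n)] (hμ : ∑ x, μ x = 1)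
    (hind : ∀ B : Finset (Fin n), ex μ (fun x => ∏ j ∈ B, f j x) = ∏ j ∈ B, ex μ (f j))
    {A : Finset (Fin n)} (hA : 2 ≤ A.card) : ncs μ f A = 0 := by
  classical
  have hAne : A.Nonempty := card_pos.1 (by omega)
  rw [ncs_eq_neg_cycleSum μ f hAne, neg_eq_zero]
  obtain ⟨m, hm⟩ : ∃ m, A.card = m + 2 := ⟨A.card - 2, by omega⟩
  let e : Fin (m + 2) ≃ {x // x ∈ A} := (A.orderIsoOfFin hm).toEquiv
  rw [← cycleSum_comp_equiv μ e, ← sahiE_eq_cycleSum μ (by omega)]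
  refine sahiE_eq_zero_of_indep μ hμ (fun i => f (e i)) fun B => ?_
  have hinj : Function.Injective (fun i : Fin (m + 2) => ((e i : {x // x ∈ A}) : Fin n)) :=
    fun i i' h => e.injective (Subtype.ext h)
  have h1 := hind (B.map ⟨fun i => ((e i : {x // x ∈ A}) : Fin n), hinj⟩)
  simp only [prod_map, Embedding.coeFn_mk] at h1
  exact h1

/-- **CLOSED FORM WITH AN INDEPENDENT TAIL**: for mutually independent `f_0,…,f_n` (all joint moments factor) under a weight of mass one
and an ARBITRARY head `g`,
`E_{n+2}(g, f) = (n+1)!·E[g·Π_j f_j] − n!·Σ_j E[f_j]·E[g·Π_{k≠j} f_k]`. [this work] -/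
theorem sahiE_cons_eq_of_indep_tail (hμ : ∑ x, μ x = 1) (g : α → ℝ) (f : Fin (n + 1) → α → ℝ)
    (hind : ∀ B : Finset (Fin (n + 1)), ex μ (fun x => ∏ j ∈ B, f j x) = ∏ j ∈ B, ex μ (f j)) :
    sahiE μ (n + 2) (Fin.cons g f) =
      ((n + 1).factorial : ℝ) * ex μ (fun x => g x * ∏ j, f j x) -
        (n.factorial : ℝ) * ∑ j, ex μ (f j) * ex μ (fun x => g x * ∏ k ∈ univ.erase j, f k x) := by
  classical
  rw [sahiE_cons_eq_sum_powerset]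
  -- only `S = univ` and `S = univ.erase j` survive
  set F : Finset (Fin (n + 1)) → ℝ := fun S =>
    (S.card.factorial : ℝ) * ex μ (fun x => g x * ∏ j ∈ S, f j x) * ncs μ f (univ \ S) with hF
  have hzero : ∀ S ∈ (univ : Finset (Fin (n + 1))).powerset, 2 ≤ (univ \ S).card → F S = 0 := by
    intro S _ h2
    simp only [hF, ncs_eq_zero_of_indep μ f hμ hind h2, mul_zero]
  have hsplit : ∑ S ∈ (univ : Finset (Fin (n + 1))).powerset, F S =
      ∑ S ∈ (univ : Finset (Fin (n + 1))).powerset.filter (fun S => (univ \ S).card ≤ 1), F S := by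
    rw [sum_filter]
    refine sum_congr rfl fun S hS => ?_
    split_ifs with h
    · rfl
    · exact hzero S hS (by omega)
  rw [show (∑ S ∈ (univ : Finset (Fin (n + 1))).powerset,
      (S.card.factorial : ℝ) * ex μ (fun x => g x * ∏ j ∈ S, f j x) * ncs μ f (univ \ S)) =
      ∑ S ∈ (univ : Finset (Fin (n + 1))).powerset, F S from rfl, hsplit]
  -- the filter is `{univ} ∪ {univ.erase j}`
  have hfilter : (univ : Finset (Fin (n + 1))).powerset.filter (fun S => (univ \ S).card ≤ 1) =
      insert univ (univ.image fun j : Fin (n + 1) => univ.erase j) := by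
    ext S
    simp only [mem_filter, mem_powerset, subset_univ, true_and, mem_insert, mem_image, mem_univ]
    constructor
    · intro h
      rcases Nat.le_one_iff_eq_zero_or_eq_one.1 h with h0 | h1
      · left
        rw [card_eq_zero, sdiff_eq_empty_iff_subset] at h0
        exact Subset.antisymm (subset_univ _) h0
      · right
        obtain ⟨j, hj⟩ := card_eq_one.1 h1
        refine ⟨j, ?_⟩
        have hjS : j ∉ S := by
          have : j ∈ univ \ S := by rw [hj]; exact mem_singleton_self j
          exact (mem_sdiff.1 this).2
        ext k
        rw [mem_erase]
        constructor
        · rintro ⟨hkj, -⟩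
          by_contra hkS
          have : k ∈ univ \ S := mem_sdiff.2 ⟨mem_univ _, hkS⟩
          rw [hj, mem_singleton] at this
          exact hkj this
        · intro hkS
          exact ⟨fun hkj => hjS (hkj ▸ hkS), mem_univ _⟩
    · rintro (rfl | ⟨j, rfl⟩)
      · simp
      · rw [sdiff_erase (mem_univ j), sdiff_self, bot_eq_empty, insert_empty_eq, card_singleton]
  rw [hfilter, sum_insert, sum_image]
  · -- evaluate the two kinds of terms
    have huniv : F univ = ((n + 1).factorial : ℝ) * ex μ (fun x => g x * ∏ j, f j x) := by
      simp only [hF, card_univ, Fintype.card_fin, sdiff_self, bot_eq_empty, ncs_empty, mul_one]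
    have herase : ∀ j : Fin (n + 1), F (univ.erase j) =
        -((n.factorial : ℝ) * (ex μ (f j) * ex μ (fun x => g x * ∏ k ∈ univ.erase j, f k x))) := by
      intro j
      simp only [hF, card_erase_of_mem (mem_univ j), card_univ, Fintype.card_fin, Nat.add_sub_cancel,
        sdiff_erase (mem_univ j), sdiff_self, bot_eq_empty, insert_empty_eq, ncs_singleton]
      ring
    rw [huniv, sum_congr rfl fun j _ => herase j, sum_neg_distrib, mul_sum]
    ring
  · intro j _ j' _ h
    by_contra hne
    have h' : univ.erase j = univ.erase j' := h
    have : j' ∈ univ.erase j := mem_erase.2 ⟨Ne.symm hne, mem_univ _⟩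
    rw [h'] at this
    exact (notMem_erase j' univ) this
  · rw [mem_image]
    rintro ⟨j, _, hj⟩
    have : j ∈ univ.erase j := by rw [hj]; exact mem_univ j
    exact (notMem_erase j univ) this

end IndependentTail

end SahiAbsorbed

end Summit.CriticalPhenomena.PercolationContinuityZ3.Theorems
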